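import Summits.RiemannHypothesis.RiemannHypothesis.Theses.RuelleBand
import Literature.NumberTheory.LFunctions.GeneralizedRH
import Literature.NumberTheory.DiophantineGeometry.NamedHypothesesRHProofs
import Literature.NumberTheory.LFunctions.ZetaArgumentCertificate
import Literature.Barriers.RiemannHypothesis.PseudoLaplacianSpacing

/-!
# `ExactFirstBand` (crux stmt-RiemannHypothesis-2061, route RuelleBand) — why it resists disproof; counterexample normal forms

Negative-side support file of the crux disprover (cdisprove seat, cycle 1). The crux (thesis X, rank 0) is
`ExactFirstBand := ∀ s : ℂ, riemannZeta s = 0 → 0 < s.re → s.re < 1 → s.re = 1 / 2 ∨ s.im = 0`.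
Kernel-checked findings, statements inline:

* `exactFirstBand_iff_strip`, `exactFirstBand_iff_riemannHypothesis`, `not_exactFirstBand_iff_not_riemannHypothesis`
  — the disjunct `s.im = 0` is dead weight for `ζ` (`ζ(σ) < 0` on `(0,1)`), so X is verbatim the strip form of
  RH and is equivalent to Mathlib's `RiemannHypothesis`: a kill of the crux is a disproof of RH.
* `not_exactFirstBand_iff_exists_offLine`, `…_exists_quadrant` — a kill is one off-line zero, w.l.o.g. in the open
  quadrant `1/2 < re s < 1`, `im s > 0` (symmetries `s ↦ 1 - s`, `s ↦ conj s`); `offLine_quadruple` — it comes with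
  three more, pairwise distinct.
* `exactFirstBand_iff_forall_upTo` — X ⟺ RH up to every height; a kill, if any, is finitely certifiable.
* `re_eq_half_of_abs_im_le_sixteen`, `not_exactFirstBand_iff_exists_above_sixteen` — UNCONDITIONALLY a kill has
  height `> 16` (RH up to height 16 is a kernel-checked theorem of the tree, Backlund's certificate);
  `not_exactFirstBand_iff_exists_above_plattTrudgian` — height `> 3 000 175 332 800` modulo the named numerical
  fact `riemannHypothesisUpTo_platt_trudgian` (Platt–Trudgian 2021, Thm 1).
* `exactFirstBand_iff_casimir_real`, `…_casimir_ofReal` — the route's gloss "the Casimir parameter `s(1-s)` is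
  real" is an exact restatement, carrying no mechanism by itself.
-/

noncomputable section

open Complex Set
open scoped ComplexConjugate

namespace Summit.RiemannHypothesis.Cruxes.ExactFirstBand.Negative

open Summit.RiemannHypothesis.RiemannHypothesis.Theses.RuelleBand
open Literature.NumberTheory.LFunctions
open Literature.NumberTheory.DiophantineGeometry (RiemannHypothesisUpTo riemannHypothesisUpTo_platt_trudgian
  riemannHypothesisStrip_iff_forall_riemannHypothesisUpTo)

/-- The disjunct `s.im = 0` is DEAD WEIGHT for `ζ`: a zero of the open strip is never real
(`ζ(σ) < 0` on `(0,1)`, tree `riemannZeta_ne_zero_of_im_eq_zero_of_pos_of_lt_one`, Titchmarsh §2.12), so X is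
verbatim the strip form of RH (`Literature.NumberTheory.LFunctions.RiemannHypothesisStrip`).
[cite: Titchmarsh1986, §2.12] -/
theorem exactFirstBand_iff_strip : ExactFirstBand ↔ RiemannHypothesisStrip := by
  refine ⟨fun h s hs h0 h1 => ?_, fun h s hs h0 h1 => Or.inl (h s hs h0 h1)⟩
  exact (h s hs h0 h1).resolve_right (im_ne_zero_of_riemannZeta_eq_zero hs h0 h1)

/-- X ⟺ Mathlib's `RiemannHypothesis` (kill criterion (iv) of the route as a Lean theorem: a disproof of the
crux is a disproof of RH). [folklore] -/
theorem exactFirstBand_iff_riemannHypothesis : ExactFirstBand ↔ RiemannHypothesis :=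
  exactFirstBand_iff_strip.trans (riemannHypothesis_iff_strip_holds : RiemannHypothesis ↔ _).symm

/-- Hence `¬X ⟺ ¬RH`. [folklore] -/
theorem not_exactFirstBand_iff_not_riemannHypothesis : ¬ ExactFirstBand ↔ ¬ RiemannHypothesis :=
  not_congr exactFirstBand_iff_riemannHypothesis

/-- COUNTEREXAMPLE NORMAL FORM (1): a kill is exactly one off-line zero of the open strip; it is then
automatically non-real. [folklore] -/
theorem not_exactFirstBand_iff_exists_offLine :
    ¬ ExactFirstBand ↔ ∃ s : ℂ, riemannZeta s = 0 ∧ 0 < s.re ∧ s.re < 1 ∧ s.re ≠ 1 / 2 ∧ s.im ≠ 0 := by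
  constructor
  · intro h
    by_contra hne
    apply h
    intro s hs h0 h1
    by_contra hor
    push Not at hor
    exact hne ⟨s, hs, h0, h1, hor.1, hor.2⟩
  · rintro ⟨s, hs, h0, h1, hne, him⟩ h
    rcases h s hs h0 h1 with h' | h'
    exacts [hne h', him h']

/-- COUNTEREXAMPLE NORMAL FORM (2): by the symmetries `s ↦ 1 - s` (functional equation, tree
`GeneralizedRH.riemannZeta_one_sub_eq_zero`) and `s ↦ conj s` (Mathlib `riemannZeta_conj`) of the zero set,
a kill may be sought in the open quadrant `1/2 < re s < 1`, `im s > 0` only. [cite: Titchmarsh1986, §2.12] -/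
theorem not_exactFirstBand_iff_exists_quadrant :
    ¬ ExactFirstBand ↔ ∃ s : ℂ, riemannZeta s = 0 ∧ 1 / 2 < s.re ∧ s.re < 1 ∧ 0 < s.im := by
  rw [not_exactFirstBand_iff_exists_offLine]
  constructor
  · rintro ⟨s, hs, h0, h1, hne, him⟩
    obtain ⟨u, hu, hu0, hu1, huim⟩ :
        ∃ u : ℂ, riemannZeta u = 0 ∧ 1 / 2 < u.re ∧ u.re < 1 ∧ u.im ≠ 0 := by
      rcases lt_or_gt_of_ne hne with hlt | hgt
      · refine ⟨1 - s, GeneralizedRH.riemannZeta_one_sub_eq_zero hs h0 h1, ?_, ?_, ?_⟩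
        · simp only [sub_re, one_re]; linarith
        · simp only [sub_re, one_re]; linarith
        · simpa [sub_im] using him
      · exact ⟨s, hs, hgt, h1, him⟩
    rcases lt_or_gt_of_ne huim with hneg | hpos
    · refine ⟨conj u, ?_, ?_, ?_, ?_⟩
      · rw [riemannZeta_conj, hu, map_zero]
      · simpa using hu0
      · simpa using hu1
      · rw [conj_im]; linarith
    · exact ⟨u, hu, hu0, hu1, hpos⟩
  · rintro ⟨s, hs, h0, h1, him⟩
    exact ⟨s, hs, by linarith, h1, by intro h; linarith, him.ne'⟩

/-- COUNTEREXAMPLE STRUCTURE: a kill `s` brings three more — `conj s`, `1 - s`, `1 - conj s` — and the four are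
pairwise distinct (off the line and off the axis the Klein four-group of symmetries acts freely). [cite: Titchmarsh1986, §2.12] -/
theorem offLine_quadruple {s : ℂ} (hs : riemannZeta s = 0) (h0 : 0 < s.re) (h1 : s.re < 1)
    (hne : s.re ≠ 1 / 2) :
    (riemannZeta (conj s) = 0 ∧ riemannZeta (1 - s) = 0 ∧ riemannZeta (1 - conj s) = 0) ∧
      s ≠ conj s ∧ s ≠ 1 - s ∧ s ≠ 1 - conj s ∧ conj s ≠ 1 - s ∧ conj s ≠ 1 - conj s ∧
        1 - s ≠ 1 - conj s := by
  have him : s.im ≠ 0 := im_ne_zero_of_riemannZeta_eq_zero hs h0 h1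
  have hc : riemannZeta (conj s) = 0 := by rw [riemannZeta_conj, hs, map_zero]
  have h1s : riemannZeta (1 - s) = 0 := GeneralizedRH.riemannZeta_one_sub_eq_zero hs h0 h1
  have h1c : riemannZeta (1 - conj s) = 0 :=
    GeneralizedRH.riemannZeta_one_sub_eq_zero hc (by simpa using h0) (by simpa using h1)
  refine ⟨⟨hc, h1s, h1c⟩, ?_, ?_, ?_, ?_, ?_, ?_⟩ <;> intro h
  · have := congrArg Complex.im h
    rw [conj_im] at this
    exact him (by linarith)
  · have := congrArg Complex.re h
    rw [sub_re, one_re] at this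
    exact hne (by linarith)
  · have := congrArg Complex.re h
    rw [sub_re, one_re, conj_re] at this
    exact hne (by linarith)
  · have := congrArg Complex.re h
    rw [conj_re, sub_re, one_re] at this
    exact hne (by linarith)
  · have := congrArg Complex.re h
    rw [sub_re, one_re, conj_re] at this
    exact hne (by linarith)
  · have := congrArg Complex.im h
    rw [sub_im, one_im, sub_im, one_im, conj_im] at this
    exact him (by linarith)

/-- X ⟺ "RH up to every height `T`" (`RiemannHypothesisUpTo T`: every zero with `0 < im s ≤ T` has
`re s = 1/2`; tree `riemannHypothesisStrip_iff_forall_riemannHypothesisUpTo`). A kill is a failure of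
numerical RH verification at SOME finite height — certifiable by a finite computation if it exists, unlike rung
#5 `CofiniteCriticalLine`, which no finite computation refutes. [folklore] -/
theorem exactFirstBand_iff_forall_upTo : ExactFirstBand ↔ ∀ T : ℝ, RiemannHypothesisUpTo T :=
  exactFirstBand_iff_strip.trans riemannHypothesisStrip_iff_forall_riemannHypothesisUpTo

/-- BOUNDED SEARCH, KERNEL-CHECKED: there is no counterexample of height `≤ 16` — RH up to height 16 is a
THEOREM of the tree (`riemannHypothesisUpTo_sixteen`, Backlund's certificate `N(16) = 1 = N₀(16)` checked by
the kernel), extended to negative heights by conjugation and to height `0` by `ζ(σ) < 0` on `(0,1)`.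
[cite: Edwards1974, §6.6] -/
theorem re_eq_half_of_abs_im_le_sixteen {s : ℂ} (hs : riemannZeta s = 0) (h0 : 0 < s.re) (h1 : s.re < 1)
    (h16 : |s.im| ≤ 16) : s.re = 1 / 2 := by
  rcases lt_trichotomy s.im 0 with him | him | him
  · exact riemannHypothesisUpTo_sixteen.re_eq_of_im_neg hs him (by rwa [abs_of_neg him] at h16)
  · exact absurd hs (riemannZeta_ne_zero_of_im_eq_zero_of_pos_of_lt_one him h0 h1)
  · exact riemannHypothesisUpTo_sixteen s hs him (by rwa [abs_of_pos him] at h16)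

/-- COUNTEREXAMPLE NORMAL FORM (3, unconditional): a kill is a zero with `1/2 < re s < 1` and `im s > 16`.
[cite: Edwards1974, §6.6] -/
theorem not_exactFirstBand_iff_exists_above_sixteen :
    ¬ ExactFirstBand ↔ ∃ s : ℂ, riemannZeta s = 0 ∧ 1 / 2 < s.re ∧ s.re < 1 ∧ 16 < s.im := by
  rw [not_exactFirstBand_iff_exists_quadrant]
  constructor
  · rintro ⟨s, hs, h0, h1, him⟩
    refine ⟨s, hs, h0, h1, ?_⟩
    by_contra hle
    have := re_eq_half_of_abs_im_le_sixteen hs (by linarith) h1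
      (by rw [abs_of_pos him]; exact not_lt.1 hle)
    linarith
  · rintro ⟨s, hs, h0, h1, him⟩
    exact ⟨s, hs, h0, h1, by linarith⟩

/-- COUNTEREXAMPLE NORMAL FORM (4, modulo the named numerical fact `riemannHypothesisUpTo_platt_trudgian` =
Platt–Trudgian 2021, Thm 1, RH up to height `3 000 175 332 800`): a kill is a zero with `1/2 < re s < 1` and
`im s > 3 000 175 332 800`; no counterexample search below that height is meaningful.
[cite: PlattTrudgianBLMS2021, Theorem 1] -/
theorem not_exactFirstBand_iff_exists_above_plattTrudgian (hPT : riemannHypothesisUpTo_platt_trudgian) :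
    ¬ ExactFirstBand ↔
      ∃ s : ℂ, riemannZeta s = 0 ∧ 1 / 2 < s.re ∧ s.re < 1 ∧ (3000175332800 : ℝ) < s.im := by
  rw [not_exactFirstBand_iff_exists_quadrant]
  constructor
  · rintro ⟨s, hs, h0, h1, him⟩
    refine ⟨s, hs, h0, h1, ?_⟩
    by_contra hle
    have := hPT s hs him (not_lt.1 hle)
    linarith
  · rintro ⟨s, hs, h0, h1, him⟩
    exact ⟨s, hs, h0, h1, by linarith⟩

/-- CASIMIR FORM (the route's own gloss "the Casimir parameter `s(1-s)` is real"): X ⟺ every zero of the open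
strip has `(s(1-s)).im = 0` (tree lemma `Literature.Barriers.RiemannHypothesis.mul_one_sub_im_eq_zero_iff`).
An exact restatement: it names no operator and carries no mechanism. [folklore] -/
theorem exactFirstBand_iff_casimir_real :
    ExactFirstBand ↔ ∀ s : ℂ, riemannZeta s = 0 → 0 < s.re → s.re < 1 → (s * (1 - s)).im = 0 := by
  show (∀ s : ℂ, riemannZeta s = 0 → 0 < s.re → s.re < 1 → s.re = 1 / 2 ∨ s.im = 0) ↔ _
  simp only [Literature.Barriers.RiemannHypothesis.mul_one_sub_im_eq_zero_iff]

/-- … equivalently `s(1-s)` is a real number. [folklore] -/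
theorem exactFirstBand_iff_casimir_ofReal :
    ExactFirstBand ↔ ∀ s : ℂ, riemannZeta s = 0 → 0 < s.re → s.re < 1 → ∃ μ : ℝ, s * (1 - s) = μ := by
  rw [exactFirstBand_iff_casimir_real]
  refine forall₄_congr fun s _ _ _ => ⟨fun h => ⟨(s * (1 - s)).re, ?_⟩, ?_⟩
  · exact Complex.ext (by simp) (by simp [h])
  · rintro ⟨l, hl⟩
    rw [hl, ofReal_im]

end Summit.RiemannHypothesis.Cruxes.ExactFirstBand.Negative

end
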